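import Summits.Ventures.Crystal3D.Bulk.SphereCodeCut
import Summits.Ventures.PackingBounds.ThreePointCert.SoundDim3
import Summits.Ventures.PackingBounds.ThreePointCert.CheckKron
import Summits.Ventures.Crystal3D.TopCut.T13c2593ExpandR1
import Summits.Ventures.Crystal3D.TopCut.T13c2593ExpandR2
import Summits.Ventures.Crystal3D.TopCut.T13c2593ExpandR3
import Summits.Ventures.Crystal3D.TopCut.T13c2593ExpandR4
import Summits.Ventures.Crystal3D.TopCut.T13c2593ExpandQG1
import Summits.Ventures.Crystal3D.TopCut.T13c2593ExpandQG2
import Summits.Ventures.Crystal3D.TopCut.T13c2593ExpandQG3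

/-!
# T13(arccos(2593/5000)): A(3, 2593/5000) ≤ 12: the kernel-checked theorem

HONEST FRAMING: generated data / kernel-validation file of the venture `Crystal3D` (cell `pub-crystal3d`,
phase 2, seat p2): one piece of the kernel replay of an EXACT Bachoc–Vallentin three-point certificate on `S²`
(n = 3, s = 2593/5000, degree d = 8, Bachoc–Vallentin multiplier set) proving `A(3, s) ≤ 12` — the
"SDP top cut" `T13(arccos s)` of the sticky-sphere programme (no 13 unit vectors of `ℝ³` pairwise `≥ arccos s` apart).
Source certificate: `cert_d8N8_c2593over5000_j175130.json` (pub-crystal3d phase2/sdp-topcut, p2 g6: CLARABEL float solve → rational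
rounding → exact verification ×2, verify_bv + theory-2 verify2), converted by `cert2lean_p2.py` (an input adapter of
pub-packcert-sdp `cert2lean_s2.py`) into the integer units of the EXISTING tree checker of the venture `PackingBounds`
(cell `pub-packcert`): `ThreePointCert.Check` + `CheckDim3` + `CheckSym2` (soundness `SoundDim3.card_le_of_cert33S2`),
Gram factors offset-encoded for the Kronecker-packed chunk validation `ThreePointCert.CheckKron`; file layout of their
emitter `emitleanS2.py` (Leaf / Agg / Expand / Proof). Nothing geometric is proved in this file; plain lists of integers /
monomials and `decide +kernel` facts about them (standard axioms only, no `native_decide`).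
-/

namespace Summit.Ventures.Crystal3D.TopCut.T13c2593

open Literature.Geometry.DiscreteGeometry Literature.Geometry.DiscreteGeometry.PolyCert PolyCert.SPoly
open Summit.Ventures.PackingBounds.ThreePointCert

set_option maxRecDepth 100000 in
/-- All expansion data are valid (assembled from the kernel validations). -/
theorem polys_ok : PolysOK33 T13c2593.cert T13c2593.polys T13c2593.gR0 T13c2593.gR1 T13c2593.gR2 T13c2593.gR3 T13c2593.gR4 T13c2593.gQ0 T13c2593.gQ1 where
  hF := fexpValid3_of_fchunkVal cert eFP _ (by rfl) (fchunkVal3_append _ _ _ _ _ _ (fchunkVal3_append _ _ _ _ _ _ (fchunkVal3_append _ _ _ _ _ _ (fchunkVal3_append _ _ _ _ _ _ (fchunkVal3_append _ _ _ _ _ _ (fchunkVal3_append _ _ _ _ _ _ (fchunkVal3_append _ _ _ _ _ _ (fchunkVal3_of_ok _ _ _ _ okF_1) (fchunkVal3_of_ok _ _ _ _ okF_2)) (fchunkVal3_of_ok _ _ _ _ okF_3)) (fchunkVal3_of_ok _ _ _ _ okF_4)) (fchunkVal3_of_ok _ _ _ _ okF_5)) (fchunkVal3_of_ok _ _ _ _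 okF_6)) (fchunkVal3_of_ok _ _ _ _ okF_7)) (fchunkVal3_of_ok _ _ _ _ okF_8))
  h0 := by
    have c := chunkVal_of_okK _ _ _ _ _ okR0_1
    have c := chunkVal_trans _ _ _ _ _ _ _ c (chunkVal_of_okK _ _ _ _ _ okR0_2)
    have c := chunkVal_trans _ _ _ _ _ _ _ c (chunkVal_of_okK _ _ _ _ _ okR0_3)
    have c := chunkVal_trans _ _ _ _ _ _ _ c (chunkVal_of_okK _ _ _ _ _ okR0_4)
    have c := chunkVal_trans _ _ _ _ _ _ _ c (chunkVal_of_okK _ _ _ _ _ okR0_5)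
    exact c
  h1 := by
    have c := chunkVal_of_okK _ _ _ _ _ okR1_1
    have c := chunkVal_trans _ _ _ _ _ _ _ c (chunkVal_of_okK _ _ _ _ _ okR1_2)
    exact c
  h2 := rvalid_of_singleK gR2K eR2 okR2_1
  h3 := rvalid_of_singleK gR3K eR3 okR3_1
  h4 := rvalid_of_singleK gR4K eR4 okR4_1
  hq0 := rvalid_of_singleK gQ0K eQ0 okQ0_1
  hq1 := rvalid_of_singleK gQ1K eQ1 okQ1_1

set_option maxHeartbeats 0 in
/-- The side conditions hold. -/
theorem cert_side : checkSide33 T13c2593.cert = true := by decide +kernel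

set_option maxHeartbeats 0 in
/-- The numerical bound is `< N + 1` (and `≥ 0`). -/
theorem cert_bound : checkBound3 T13c2593.cert T13c2593.polys = true := by decide +kernel

set_option maxRecDepth 100000 in
set_option maxHeartbeats 0 in
/-- The certificate passes the check of constraint `(i')`. -/
theorem cert_I : checkI3 T13c2593.cert T13c2593.polys = true := by decide +kernel

set_option maxRecDepth 100000 in
set_option maxHeartbeats 0 in
/-- The certificate passes the check of constraint `(ii')` (Bachoc–Vallentin multiplier set). -/
theorem cert_II : checkII3S2 T13c2593.cert T13c2593.polys = true := by decide +kernel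

/-- **T13(arccos(2593/5000)): A(3, 2593/5000) ≤ 12**: every finite set of unit vectors of `ℝ³` with pairwise inner products `≤ 2593 / 5000` has at
most `12` elements — equivalently, among any `13` points of `S²` two are at angular distance `< arccos(2593 / 5000)`
(`= 58.7616…°`), i.e. `A(3, 2593 / 5000) ≤ 12` (the "SDP top cut" `T13(arccos(2593 / 5000))` of the sticky-sphere crystallization
programme, cell pub-crystal3d). Bachoc–Vallentin three-point (semidefinite programming) bound on `S²` (Legendre /
Chebyshev kernels, their multiplier set), degree 8, from an EXACT certificate (bound value 12.989994 < 13),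
replayed by the kernel through the tree checker `ThreePointCert` (soundness `card_le_of_cert33S2`; standard axioms only).
HONEST FRAMING: an upper bound `A(3, s) ≤ 12` at this one angle — weaker than the (unformalised) Musin–Tarasov value of the
Tammes problem for 13 points; nothing about bulk crystallization is asserted here. [cite: BachocVallentin2007, Theorem 4.2] -/
theorem sphereCode_card_le_twelve_2593_5000 (C : Finset (EuclideanSpace ℝ (Fin 3)))
    (h1 : ∀ x ∈ C, ‖x‖ = 1) (h2 : ∀ x ∈ C, ∀ y ∈ C, x ≠ y → inner ℝ x y ≤ 2593 / 5000) :
    C.card ≤ 12 :=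
  card_le_of_cert33S2 cert polys polys_ok cert_I cert_II cert_side cert_bound C h1
    (fun x hx y hy hxy => by
      have h := h2 x hx y hy hxy
      have e : ((cert.p : ℤ) : ℝ) / (cert.q : ℕ) = 2593 / 5000 := by norm_num [cert]
      rw [e]; exact h)

/-- The same statement in the venture's hypothesis form: **`SphereCodeBoundInner (2593/5000)` holds** (literally the
`Bulk/SphereCodeCut` Prop, by `intro`; to be composed with `PolarContraction`/`SphereCodeCut` for the hole-radius cut). -/
theorem sphereCodeBoundInner_2593_5000 : Summit.Ventures.Crystal3D.SphereCodeBoundInner (2593 / 5000) :=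
  fun T hT hcode => sphereCode_card_le_twelve_2593_5000 T hT (fun x hx y hy hxy => by
    have h := hcode x hx y hy hxy
    norm_num at h ⊢
    exact h)

end Summit.Ventures.Crystal3D.TopCut.T13c2593
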